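/-
Copyright (c) 2026 the pub-hodgecm-mathlib formalisation cell (harness21).  Prover seat hodgecm-mathlib-K2E3-p25 (g0), HCML Track B «K2-LIT»,
h413 = `stmt-HodgeConjecture-24833`, line `K2_E3_EllipticInputs`, road (11-3-split-nsc), leaf (nsc-S-A′) `sig_K2E3GL3PrincipalBlockStandardSpan`,
brick E1 (second half) «EXPONENTS: EIGENVECTORS, FUNCTIONALS, TWISTS» of the leaf owner's memo `K2/K2E3-p25/g0/MEMO-SA-architecture.v1.K2E3-p25-g0.md`.  2026-09-04.
-/
import Summits.HodgeConjecture.HodgeConjecture.Theorems.K2E3JacquetExponentMultiset   -- brick E1 (first half): weight spaces, decomposition, additivity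
import Mathlib.LinearAlgebra.Dual.Lemmas
import Literature.NumberTheory.Automorphic.MatrixCoefficients                          -- ★ `Representation.twist`
import HarnessLib

/-!
# K2_E3 road (h413), leaf (nsc-S-A′), brick E1 (second half) — exponents of a finite-dimensional representation of a commuting family:
# COMMON EIGENVECTORS and EQUIVARIANT FUNCTIONALS on a non-zero weight space; weight spaces of TWISTS and of ONE-DIMENSIONAL CHARACTERS

Cell `pub/hodgecm-mathlib` (D-0151), Track B, seat K2E3-p25 (g0) = owner of the leaf (nsc-S-A′) «principal-block standard span for `GL₃(F)`».  Sequel of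
`K2E3JacquetExponentMultiset` (same conventions: the `χ`-weight space of `τ` is written INLINE as `⨅ m, Module.End.maxGenEigenspace (τ m) (χ m)`; THEOREMS ONLY — no
definition ∕ instance ∕ notation ∕ named fact ∕ `sorry`; `--supports stmt-HodgeConjecture-24833 --as helper`; COUNT-NEUTRAL).

THE MATHEMATICS ([Casselman1995, §4.4 p. 45, Thm. 3.2.4]; [BernsteinZelevinsky1977, Prop. 1.9 (b), §2.3]).  `M` a group acting on a finite-dimensional complex `W` by pairwise
commuting operators `τ(m)`.
* §4 a pairwise commuting family of operators on a non-zero finite-dimensional space has a COMMON EIGENVECTOR (`exists_common_eigenvector`: a stable non-zero subspace of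
  minimal dimension is acted on by scalars); hence a non-zero weight space `W_χ` contains a common eigenvector with eigencharacter exactly `χ`
  (`exists_common_eigenvector_of_weightSpace_ne_bot`), and — projecting `W ↠ W_χ` equivariantly along `⨆_{χ′≠χ} W_{χ′}` and taking a common eigenvector of the TRANSPOSED
  operators on the dual of `W_χ` — `W` carries a NON-ZERO LINEAR FUNCTIONAL with `λ(τ(m)v) = χ(m)λ(v)` (`exists_functional_of_weightSpace_ne_bot`).  Through Frobenius
  reciprocity (★ `exists_injective_intertwiningMap_parabolicIndGL`) the latter is «`χ` occurs in `E(V)` ⇒ `V ↪ Ind_B χ`» for an irreducible `V` (route «EXP», fact (X3)).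
* §5 weight spaces of a TWIST `τ ⊗ ψ` (★ `Representation.twist`; the shift between ★ `jacquetGL` and ★ `normalizedJacquetGL` is the case `ψ = δ^{-1∕2}`) and of a
  one-dimensional character `τ(m) = θ(m)·id` (`W_θ = W`, `W_χ = 0` for `χ ≠ θ`).

HONEST LABEL: HC_CM is proved only modulo the 7 printed citations (2 remaining named inputs: hLiu418 = stmt-HodgeConjecture-24832, h413 = stmt-HodgeConjecture-24833) until rung 0
closes; count-neutral generic helper.

## References
* [Casselman1995] W. Casselman, *Introduction to the theory of admissible representations of p-adic reductive groups* (draft 1 May 1995), Thm. 3.2.4, §4.4 p. 45.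
* [BernsteinZelevinsky1977] I. N. Bernstein, A. V. Zelevinsky, *Induced representations of reductive p-adic groups I*, Ann. Sci. ÉNS 10 (1977), Prop. 1.9 (b), §2.3.
-/

set_option autoImplicit false
set_option linter.dupNamespace false

noncomputable section

open Module Module.End Set Function

namespace Summit.HodgeConjecture.HodgeConjecture.Cruxes.H413.K2E3JacquetExponentEigenvector

open Summit.HodgeConjecture.HodgeConjecture.Cruxes.H413.K2E3JacquetExponentMultiset

universe u v

variable {M : Type u} [Group M]
variable {W : Type v} [AddCommGroup W] [Module ℂ W]

/-! ## §4 Common eigenvectors and equivariant functionals on a non-zero weight space -/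

/-- A non-zero finite-dimensional space with a pairwise commuting family of operators `T i` (any index type) has a COMMON EIGENVECTOR: a non-zero subspace stable
under all `T i` of minimal dimension is a subspace on which every `T i` acts by a scalar (its eigenspace there is stable and non-zero, hence everything).
[folklore] -/
theorem exists_common_eigenvector {ι : Type*} (T : ι → Module.End ℂ W) [FiniteDimensional ℂ W] [Nontrivial W] (hT : ∀ i j, Commute (T i) (T j)) :
    ∃ v : W, v ≠ 0 ∧ ∃ c : ι → ℂ, ∀ i, T i v = c i • v := by
  classical
  -- the set of dimensions of non-zero stable subspaces is non-empty (`⊤`)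
  let P : ℕ → Prop := fun d => ∃ S : Submodule ℂ W, S ≠ ⊥ ∧ (∀ i, ∀ v ∈ S, T i v ∈ S) ∧ finrank ℂ S = d
  have hP : ∃ d, P d := ⟨finrank ℂ (⊤ : Submodule ℂ W), ⊤, top_ne_bot, fun _ _ _ => Submodule.mem_top, rfl⟩
  obtain ⟨S, hS0, hSst, hSd⟩ := Nat.find_spec hP
  have hmin : ∀ S' : Submodule ℂ W, S' ≠ ⊥ → (∀ i, ∀ v ∈ S', T i v ∈ S') → finrank ℂ S ≤ finrank ℂ S' := by
    intro S' h0 hst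
    rw [hSd]
    exact Nat.find_min' hP ⟨S', h0, hst, rfl⟩
  -- every `T i` acts on `S` by a scalar
  haveI : Nontrivial S := Submodule.nontrivial_iff_ne_bot.2 hS0
  have hscalar : ∀ i, ∃ c : ℂ, ∀ v ∈ S, T i v = c • v := by
    intro i
    let A : Module.End ℂ S := (T i).restrict (fun v hv => hSst i v hv)
    obtain ⟨c, hc⟩ : ∃ c : ℂ, A.HasEigenvalue c := Module.End.exists_eigenvalue A
    -- the eigenspace of `A` for `c`, pushed into `W`, is stable and non-zero
    let E : Submodule ℂ W := (A.eigenspace c).map S.subtype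
    have hE0 : E ≠ ⊥ := by
      intro hE
      have : A.eigenspace c = ⊥ := by
        refine (Submodule.eq_bot_iff _).2 fun x hx => ?_
        have : (x : W) ∈ E := ⟨x, hx, rfl⟩
        rw [hE, Submodule.mem_bot] at this
        exact Subtype.ext this
      exact (Module.End.hasEigenvalue_iff.1 hc) this
    have hEst : ∀ j, ∀ v ∈ E, T j v ∈ E := by
      rintro j _ ⟨x, hx, rfl⟩
      refine ⟨⟨T j x, hSst j x x.2⟩, ?_, rfl⟩
      have hx1 : A x = c • x := Module.End.mem_eigenspace_iff.1 hx
      refine Module.End.mem_eigenspace_iff.2 (Subtype.ext ?_)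
      have hx' := congrArg Subtype.val hx1
      simp only [A, LinearMap.coe_restrict_apply, SetLike.val_smul] at hx' ⊢
      rw [← Module.End.mul_apply, (hT i j).eq, Module.End.mul_apply, hx', map_smul]
    have hEle : E ≤ S := by
      rintro _ ⟨x, _, rfl⟩
      exact x.2
    have hES : E = S := Submodule.eq_of_le_of_finrank_le hEle (hmin E hE0 hEst)
    refine ⟨c, fun v hv => ?_⟩
    have hvE : v ∈ E := hES ▸ hv
    obtain ⟨x, hx, rfl⟩ := hvE
    have hx1 : A x = c • x := Module.End.mem_eigenspace_iff.1 hx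
    have hx' := congrArg Subtype.val hx1
    simp only [A, LinearMap.coe_restrict_apply, SetLike.val_smul] at hx'
    simpa only [Submodule.coe_subtype] using hx'
  choose c hc using hscalar
  obtain ⟨v, hvS, hv0⟩ := (Submodule.ne_bot_iff S).1 hS0
  exact ⟨v, hv0, c, fun i => hc i v hvS⟩

/-- **A non-zero weight space contains a common eigenvector with eigencharacter EXACTLY `χ`.** [cite: Casselman1995, §4.4 p. 45] -/
theorem exists_common_eigenvector_of_weightSpace_ne_bot (τ : Representation ℂ M W) [FiniteDimensional ℂ W] (hτ : ∀ m m' : M, Commute (τ m) (τ m'))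
    (χ : M → ℂ) (h : (⨅ m, Module.End.maxGenEigenspace (τ m) (χ m)) ≠ ⊥) :
    ∃ v : W, v ≠ 0 ∧ v ∈ (⨅ m, Module.End.maxGenEigenspace (τ m) (χ m)) ∧ ∀ m, τ m v = χ m • v := by
  set E : Submodule ℂ W := ⨅ m, Module.End.maxGenEigenspace (τ m) (χ m) with hE
  -- `τ` restricted to `E`
  let τE : Representation ℂ M E :=
    { toFun := fun m => (τ m).restrict (fun v hv => apply_mem_weightSpace τ hτ χ m hv)
      map_one' := by ext v; simp
      map_mul' := fun m m' => by ext v; simp [Module.End.mul_apply] }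
  have hτE : ∀ m m' : M, Commute (τE m) (τE m') := by
    intro m m'
    ext v
    change ((τ m * τ m') (v : W) : W) = (τ m' * τ m) (v : W)
    rw [(hτ m m').eq]
  haveI : Nontrivial E := Submodule.nontrivial_iff_ne_bot.2 h
  obtain ⟨v, hv0, c, hc⟩ := exists_common_eigenvector (fun m => τE m) hτE
  have hcv : ∀ m, τ m (v : W) = c m • (v : W) := fun m => by simpa [τE] using congrArg Subtype.val (hc m)
  -- the eigenvalues are forced: `c = χ` because `v ∈ W_χ`
  have hcχ : ∀ m, c m = χ m := by
    intro m
    have hvm : (v : W) ∈ Module.End.maxGenEigenspace (τ m) (χ m) := (Submodule.mem_iInf _).1 v.2 m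
    obtain ⟨k, hk⟩ := (Module.End.mem_maxGenEigenspace _ _ _).1 hvm
    have hpow : ((τ m - χ m • (1 : Module.End ℂ W)) ^ k) (v : W) = (c m - χ m) ^ k • (v : W) := by
      clear hk
      induction k with
      | zero => simp
      | succ k ih => rw [pow_succ, Module.End.mul_apply, LinearMap.sub_apply, hcv, LinearMap.smul_apply, Module.End.one_apply, ← sub_smul, map_smul, ih,
          smul_smul, pow_succ']
    rw [hpow] at hk
    have hv0' : (v : W) ≠ 0 := fun h0 => hv0 (Subtype.ext h0)
    have h1 : (c m - χ m) ^ k = 0 := (smul_eq_zero.1 hk).resolve_right hv0'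
    exact sub_eq_zero.1 (pow_eq_zero_iff'.1 h1).1
  refine ⟨v, fun h0 => hv0 (Subtype.ext h0), v.2, fun m => ?_⟩
  rw [hcv, hcχ]

/-- On a finite-dimensional space equal to the generalised `c`-eigenspace of `f`, the power `(f − c)^{dim}` vanishes. [folklore] -/
theorem pow_finrank_sub_smul_apply_eq_zero (f : Module.End ℂ W) [FiniteDimensional ℂ W] (c : ℂ) (h : Module.End.maxGenEigenspace f c = ⊤) (v : W) :
    ((f - c • (1 : Module.End ℂ W)) ^ finrank ℂ W) v = 0 := by
  have hv : v ∈ Module.End.maxGenEigenspace f c := h ▸ Submodule.mem_top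
  rw [Module.End.maxGenEigenspace_eq_genEigenspace_finrank, Module.End.mem_genEigenspace_nat] at hv
  exact hv

/-- **A non-zero weight space carries a non-zero `χ`-EQUIVARIANT LINEAR FUNCTIONAL defined on all of `W`:** `λ ≠ 0` with `λ(τ(m) v) = χ(m) λ(v)`.  (Project onto `W_χ` along
`⨆_{χ′≠χ} W_{χ′}` — an equivariant projection since both summands are `τ`-stable — and take a common eigenvector of the transposed operators on the dual of `W_χ`.)  Through
Frobenius reciprocity this is «`χ` is a QUOTIENT character of the Jacquet module». [cite: Casselman1995, §4.4 p. 45, Thm. 3.2.4] [cite: BernsteinZelevinsky1977, Prop. 1.9 (b)] -/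
theorem exists_functional_of_weightSpace_ne_bot (τ : Representation ℂ M W) [FiniteDimensional ℂ W] (hτ : ∀ m m' : M, Commute (τ m) (τ m'))
    (χ : M → ℂ) (h : (⨅ m, Module.End.maxGenEigenspace (τ m) (χ m)) ≠ ⊥) :
    ∃ l : W →ₗ[ℂ] ℂ, l ≠ 0 ∧ ∀ m v, l (τ m v) = χ m * l v := by
  set E : Submodule ℂ W := ⨅ m, Module.End.maxGenEigenspace (τ m) (χ m) with hE
  set C : Submodule ℂ W := ⨆ (χ' : M → ℂ) (_ : χ' ≠ χ), ⨅ m, Module.End.maxGenEigenspace (τ m) (χ' m) with hC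
  have hEC : IsCompl E C := isCompl_weightSpace_biSup_ne τ hτ χ
  -- the equivariant projection `p : W → E`
  let p : W →ₗ[ℂ] E := Submodule.projectionOnto E C hEC
  have hCst : ∀ m, ∀ v ∈ C, τ m v ∈ C := fun m v hv =>
    map_biSup_ne_weightSpace_le τ τ (τ m) (fun m' w => by rw [← Module.End.mul_apply, ← Module.End.mul_apply, (hτ m m').eq]) χ ⟨v, hv, rfl⟩
  -- `τ` restricted to `E`, as a representation
  let τE : Representation ℂ M E :=
    { toFun := fun m => (τ m).restrict (fun v hv => apply_mem_weightSpace τ hτ χ m hv)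
      map_one' := by ext v; simp
      map_mul' := fun m m' => by ext v; simp [Module.End.mul_apply] }
  have hτE_apply : ∀ m (e : E), ((τE m e : E) : W) = τ m (e : W) := fun m e => rfl
  have hp : ∀ m v, p (τ m v) = τE m (p v) := by
    intro m v
    -- decompose `v = e + c'`
    obtain ⟨e, he, c', hc', rfl⟩ := Submodule.mem_sup.1 (hEC.sup_eq_top.symm ▸ Submodule.mem_top (x := v))
    have h1 : p (e + c') = ⟨e, he⟩ := by
      rw [map_add, Submodule.projectionOnto_apply_of_mem_left hEC he, Submodule.projectionOnto_apply_right hEC ⟨c', hc'⟩, add_zero]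
    have h2 : p (τ m (e + c')) = ⟨τ m e, apply_mem_weightSpace τ hτ χ m he⟩ := by
      rw [map_add, map_add, Submodule.projectionOnto_apply_of_mem_left hEC (apply_mem_weightSpace τ hτ χ m he),
        Submodule.projectionOnto_apply_right hEC ⟨τ m c', hCst m c' hc'⟩, add_zero]
    rw [h1, h2]
    exact Subtype.ext rfl
  -- the transposes on the dual of `E`
  let T : M → Module.End ℂ (Module.Dual ℂ E) := fun m => (τE m).dualMap
  have hτEcomm : ∀ m m' : M, Commute (τE m) (τE m') := by
    intro m m'
    ext v
    change ((τ m * τ m') (v : W) : W) = (τ m' * τ m) (v : W)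
    rw [(hτ m m').eq]
  have hT : ∀ m m', Commute (T m) (T m') := by
    intro m m'
    change (τE m).dualMap ∘ₗ (τE m').dualMap = (τE m').dualMap ∘ₗ (τE m).dualMap
    rw [LinearMap.dualMap_comp_dualMap, LinearMap.dualMap_comp_dualMap]
    exact congrArg LinearMap.dualMap (congrArg (fun f : Module.End ℂ E => (f : E →ₗ[ℂ] E)) (hτEcomm m' m).eq)
  haveI : Nontrivial E := Submodule.nontrivial_iff_ne_bot.2 h
  obtain ⟨μ, hμ0, c, hc⟩ := exists_common_eigenvector T hT
  -- `μ ∘ τE m = c m • μ`, and `c m = χ m` because `(τE m − χ m)` is nilpotent on `E`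
  have hμ : ∀ m (e : E), μ (τE m e) = c m * μ e := fun m e => by
    have := congrArg (fun φ : Module.Dual ℂ E => φ e) (hc m)
    simpa [T, LinearMap.dualMap_apply] using this
  have hcχ : ∀ m, c m = χ m := by
    intro m
    have htop : Module.End.maxGenEigenspace (τE m) (χ m) = ⊤ := by
      refine eq_top_iff.2 fun e _ => ?_
      have he : (e : W) ∈ ⨅ m', Module.End.maxGenEigenspace (τ m') (χ m') := e.2
      exact (mem_weightSpace_iff_of_injective τE τ E.subtype (fun m' v => rfl) Subtype.val_injective χ e).2 he |> fun h' =>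
        (Submodule.mem_iInf _).1 h' m
    -- pick `e` with `μ e ≠ 0` and iterate
    obtain ⟨e, he⟩ : ∃ e : E, μ e ≠ 0 := by
      by_contra hall
      apply hμ0
      ext e
      exact not_ne_iff.1 (fun hne => hall ⟨e, hne⟩)
    have hiter : ∀ k : ℕ, μ (((τE m - χ m • (1 : Module.End ℂ E)) ^ k) e) = (c m - χ m) ^ k * μ e := by
      intro k
      induction k with
      | zero => simp
      | succ k ih =>
        rw [pow_succ', Module.End.mul_apply, LinearMap.sub_apply, LinearMap.smul_apply, Module.End.one_apply, map_sub, map_smul, hμ, ih,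
          smul_eq_mul, pow_succ']
        ring
    have hz := hiter (finrank ℂ E)
    rw [pow_finrank_sub_smul_apply_eq_zero (τE m) (χ m) htop e, map_zero] at hz
    have h1 : (c m - χ m) ^ finrank ℂ E = 0 := (mul_eq_zero.1 hz.symm).resolve_right he
    exact sub_eq_zero.1 (pow_eq_zero_iff'.1 h1).1
  refine ⟨μ ∘ₗ p, ?_, fun m v => ?_⟩
  · -- `μ ∘ p ≠ 0`: `p` restricts to the identity on `E`
    intro h0
    apply hμ0
    ext e
    have h1 := congrArg (fun φ : W →ₗ[ℂ] ℂ => φ (e : W)) h0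
    have h2 : p (e : W) = e := Submodule.projectionOnto_apply_left hEC e
    simp only [LinearMap.coe_comp, Function.comp_apply, LinearMap.zero_apply] at h1
    rw [h2] at h1
    simpa using h1
  · change μ (p (τ m v)) = χ m * μ (p v)
    rw [hp, hμ, hcχ]

/-! ## §5 Twists and one-dimensional characters -/

/-- Scaling an operator rescales its generalised eigenvalues: `ker⋃ (a f − μ)^k = ker⋃ (f − a⁻¹μ)^k` for `a ≠ 0`. [folklore] -/
theorem maxGenEigenspace_smul_eq (f : Module.End ℂ W) {a : ℂ} (ha : a ≠ 0) (μ : ℂ) :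
    Module.End.maxGenEigenspace (a • f) μ = Module.End.maxGenEigenspace f (a⁻¹ * μ) := by
  have key : ∀ k : ℕ, (a • f - μ • (1 : Module.End ℂ W)) ^ k = a ^ k • (f - (a⁻¹ * μ) • (1 : Module.End ℂ W)) ^ k := by
    intro k
    rw [← smul_pow]
    congr 1
    rw [smul_sub, smul_smul, mul_inv_cancel_left₀ ha]
  ext v
  simp only [Module.End.mem_maxGenEigenspace, key, LinearMap.smul_apply, smul_eq_zero, pow_eq_zero_iff', ha, false_and, false_or]

/-- **Weight spaces of a twist** (★ `Representation.twist`: `(τ ⊗ ψ)(m) = ψ(m) τ(m)`): the `χ`-weight space of `τ ⊗ ψ` is the `ψ⁻¹χ`-weight space of `τ`.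
(Used with `ψ = δ_B^{∓1∕2}|_T`: normalised vs. un-normalised Jacquet module, ★ `Representation.normalizedJacquetGL`.) [cite: BernsteinZelevinsky1977, §2.3] -/
theorem weightSpace_twist_eq (τ : Representation ℂ M W) (ψ : M →* ℂˣ) (χ : M → ℂ) :
    (⨅ m, Module.End.maxGenEigenspace (τ.twist ψ m) (χ m)) = ⨅ m, Module.End.maxGenEigenspace (τ m) (((ψ m : ℂˣ) : ℂ)⁻¹ * χ m) := by
  refine iInf_congr fun m => ?_
  have h : τ.twist ψ m = ((ψ m : ℂˣ) : ℂ) • τ m := rfl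
  rw [h]
  exact maxGenEigenspace_smul_eq (τ m) (Units.ne_zero _) (χ m)

/-- Multiplicity form of `weightSpace_twist_eq`, read backwards: the `χ`-multiplicity of `τ` is the `ψχ`-multiplicity of `τ ⊗ ψ`. [cite: BernsteinZelevinsky1977, §2.3] -/
theorem weightSpace_eq_weightSpace_twist (τ : Representation ℂ M W) (ψ : M →* ℂˣ) (χ : M → ℂ) :
    (⨅ m, Module.End.maxGenEigenspace (τ m) (χ m)) = ⨅ m, Module.End.maxGenEigenspace (τ.twist ψ m) (((ψ m : ℂˣ) : ℂ) * χ m) := by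
  rw [weightSpace_twist_eq]
  refine iInf_congr fun m => ?_
  rw [inv_mul_cancel_left₀ (Units.ne_zero _)]

/-- **Weight spaces of a one-dimensional character** `τ(m) = θ(m) · id` (on any `W`): the `θ`-weight space is everything. [cite: Casselman1995, §4.4 p. 45] -/
theorem weightSpace_eq_top_of_forall_apply_eq_smul (τ : Representation ℂ M W) (θ : M → ℂ) (hτ : ∀ m v, τ m v = θ m • v) :
    (⨅ m, Module.End.maxGenEigenspace (τ m) (θ m)) = ⊤ := by
  have hτ' : ∀ m, τ m = θ m • (1 : Module.End ℂ W) := fun m => LinearMap.ext fun v => by simpa using hτ m v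
  refine eq_top_iff.2 fun v _ => (Submodule.mem_iInf _).2 fun m => (Module.End.mem_maxGenEigenspace _ _ _).2 ⟨1, ?_⟩
  simp [hτ']

/-- **Weight spaces of a one-dimensional character**, continued: for `χ ≠ θ` the `χ`-weight space of `τ(m) = θ(m) · id` is zero. [cite: Casselman1995, §4.4 p. 45] -/
theorem weightSpace_eq_bot_of_forall_apply_eq_smul_of_ne (τ : Representation ℂ M W) (θ : M → ℂ) (hτ : ∀ m v, τ m v = θ m • v) {χ : M → ℂ} (hχ : χ ≠ θ) :
    (⨅ m, Module.End.maxGenEigenspace (τ m) (χ m)) = ⊥ := by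
  have hτ' : ∀ m, τ m = θ m • (1 : Module.End ℂ W) := fun m => LinearMap.ext fun v => by simpa using hτ m v
  obtain ⟨m, hm⟩ : ∃ m, χ m ≠ θ m := by
    by_contra hall
    apply hχ
    funext m
    exact not_ne_iff.1 (fun hne => hall ⟨m, hne⟩)
  refine (Submodule.eq_bot_iff _).2 fun v hv => ?_
  have hvm := (Submodule.mem_iInf _).1 hv m
  obtain ⟨k, hk⟩ := (Module.End.mem_maxGenEigenspace _ _ _).1 hvm
  have hpow : ((τ m - χ m • (1 : Module.End ℂ W)) ^ k) v = (θ m - χ m) ^ k • v := by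
    rw [hτ', ← sub_smul, smul_pow, one_pow, LinearMap.smul_apply, Module.End.one_apply]
  rw [hpow, smul_eq_zero] at hk
  rcases hk with hk | hk
  · exact absurd (sub_eq_zero.1 (pow_eq_zero_iff'.1 hk).1).symm hm
  · exact hk

end Summit.HodgeConjecture.HodgeConjecture.Cruxes.H413.K2E3JacquetExponentEigenvector
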